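import Literature.Analysis.FluidPDE.ElgindiHalfPiRegularity
import Literature.Analysis.FluidPDE.ElgindiSlabSmoothness
import HarnessLib

/-!
# The tangential family is `C^∞` up to both angular boundaries, in the coordinates `(θ, log R)`
# and `(π/2 − θ, log R)` ([Elgindi2021] §7.1 Proposition 7.1)

Topic `Literature/Analysis/FluidPDE`. Proof file (everything proved, no definitions, no named
facts) on the proof path of the named fact
`Literature.Analysis.FluidPDE.Elgindi.ElgindiGhoulMasmoudi2021_stabilityCore`
(`ElgindiStabilityDecomposition.lean`). T. M. Elgindi, Ann. of Math. 194 (2021) =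
arXiv:1904.04795, §7.1 Proposition 7.1 (p. 19 of the held text).

For a `TangentialFamily α f Ψ` the two families of mixed partials
`(k,l) ↦ ∂_θ^l D_R^kΨ` (at `θ = 0`, slab `[0,π/4)`) and `(k,l) ↦ ∂_σ^l z_k`,
`z_k = D_R^kΨ(R,π/2−σ)/sin σ` (at `θ = π/2`, slab `[0,π/2)`) are `SlabFamily`s
(`slabFamily_zero`, `slabFamily_halfPi`): continuity up to the boundary is the content of
`ElgindiThetaZeroRegularity.lean` / `ElgindiHalfPiRegularity.lean`, and `D_R` commutes with `∂_θ^l`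
on the strip (`Dz_iterate_dθ_strip`). Hence `(θ,s) ↦ Ψ̃(eˢ,θ)` is `C^∞` on `[0,π/4) × ℝ` and
`(σ,s) ↦ z̃₀(eˢ,σ)` is `C^∞` on `[0,π/2) × ℝ`, within (`contDiffOn_slab_zero`,
`contDiffOn_slab_halfPi`).
-/

noncomputable section

open MeasureTheory Set Real Filter Function
open _root_.Topology
open scoped ContDiff

namespace Literature.Analysis.FluidPDE

namespace Elgindi

/-! ### `D_R` commutes with `∂_θ^l` on the strip -/

/-- `D_R(∂_θg) = ∂_θ(D_Rg)` on the strip for `g ∈ C^∞(strip)`. [folklore] -/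
theorem Dz_dθ_strip {g : ℝ → ℝ → ℝ} (hg : ContDiffOn ℝ ∞ (uncurry g) strip) {p : ℝ × ℝ} (hp : p ∈ strip) :
    Dz (dθ g) p.1 p.2 = dθ (Dz g) p.1 p.2 := by
  have h2 : ContDiffOn ℝ 2 (uncurry g) strip := contDiffOn_nat_of_infty hg 2
  have h1 := dθ_dz_eq_dz_dθ h2 hp
  have e : dθ (Dz g) p.1 p.2 = p.1 * dθ (dz g) p.1 p.2 := by
    show deriv (fun θ' => p.1 * dz g p.1 θ') p.2 = _; exact deriv_const_mul_field _
  rw [e, h1]; rfl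

/-- **`D_R(∂_θ^l g) = ∂_θ^l(D_Rg)` on the strip.** [folklore] -/
theorem Dz_iterate_dθ_strip {g : ℝ → ℝ → ℝ} (hg : ContDiffOn ℝ ∞ (uncurry g) strip) (l : ℕ) :
    ∀ p ∈ strip, Dz (dθ^[l] g) p.1 p.2 = (dθ^[l] (Dz g)) p.1 p.2 := by
  induction l generalizing g with
  | zero => intro p _; rfl
  | succ l ih =>
    intro p hp
    rw [Function.iterate_succ_apply, Function.iterate_succ_apply]
    -- `D_R(∂_θ^l(∂_θ g)) = ∂_θ^l(D_R ∂_θ g) = ∂_θ^l(∂_θ D_R g)`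
    rw [ih (contDiffOn_dθ_strip hg) p hp]
    exact iterate_dθ_congr (fun q hq => Dz_dθ_strip hg hq) l p hp

/-- Radial slices of strip-smooth functions have derivative `∂_Rg = D_Rg/R`. [folklore] -/
theorem hasDerivAt_radial_Dz {g : ℝ → ℝ → ℝ} (hg : ContDiffOn ℝ ∞ (uncurry g) strip) {p : ℝ × ℝ} (hp : p ∈ strip) :
    HasDerivAt (fun R' => g R' p.2) (Dz g p.1 p.2 / p.1) p.1 := by
  have h := hasDerivAt_radial_slice (contDiffOn_nat_of_infty hg 1) hp.2 hp.1
  refine h.congr_deriv ?_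
  show dz g p.1 p.2 = p.1 * dz g p.1 p.2 / p.1
  rw [mul_comm, mul_div_assoc, div_self (ne_of_gt hp.1), mul_one]

namespace TangentialFamily

variable {α : ℝ} {f Ψ : ℝ → ℝ → ℝ} (h : TangentialFamily α f Ψ)
include h

/-! ### The family at `θ = 0` -/

/-- **The mixed partials `∂_θ^l D_R^kΨ` form a `SlabFamily` on `[0,π/4)`.** [folklore] -/
theorem slabFamily_zero : SlabFamily (π / 4) (fun k l => dθ^[l] (Dz^[k] Ψ)) := by
  have hπ4 : (0:ℝ) < π / 4 := by positivity
  have hsub : ∀ {p : ℝ × ℝ}, p ∈ Ioi (0:ℝ) ×ˢ Ioo (0:ℝ) (π / 4) → p ∈ strip := fun hp =>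
    ⟨hp.1, hp.2.1, hp.2.2.trans (by linarith [Real.pi_pos])⟩
  refine ⟨hπ4, fun k l => h.continuousOn_bext_iterate k l, fun k l p hp => ?_, fun k l p hp => ?_⟩
  · -- `σ`-derivative (here `σ = θ`)
    have hs : ContDiffOn ℝ ∞ (uncurry (dθ^[l] (Dz^[k] Ψ))) strip := contDiffOn_iterate_dθ_strip (h.smooth_iterate k) l
    have := h.hasDerivAt_sigma hs (hsub hp)
    rwa [← Function.iterate_succ_apply' dθ l] at this
  · -- `R`-derivative
    have hs : ContDiffOn ℝ ∞ (uncurry (dθ^[l] (Dz^[k] Ψ))) strip := contDiffOn_iterate_dθ_strip (h.smooth_iterate k) l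
    have hd := hasDerivAt_radial_Dz hs (hsub hp)
    rw [Dz_iterate_dθ_strip (h.smooth_iterate k) l p (hsub hp), ← iterate_succ] at hd
    exact hd

/-- **`(θ,s) ↦ Ψ̃(eˢ,θ)` is `C^∞` on `[0,π/4) × ℝ` (within).** [cite: Elgindi2021, §7.1 Proposition 7.1 (p. 19 of arXiv:1904.04795)] -/
theorem contDiffOn_slab_zero : ContDiffOn ℝ ∞ (fun q : ℝ × ℝ => bext Ψ (Real.exp q.2, q.1)) (Ico 0 (π / 4) ×ˢ univ) :=
  h.slabFamily_zero.contDiffOn_slab 0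

/-! ### The family at `θ = π/2` -/

/-- `D_R z_k = z_{k+1}` (everywhere). [folklore] -/
theorem Dz_zRefl (k : ℕ) : Dz (zRefl Ψ k) = zRefl Ψ (k + 1) := by
  have := h
  funext R σ
  show R * deriv (fun R' => (Dz^[k] Ψ) R' (π / 2 - σ) / Real.sin σ) R = (Dz^[k + 1] Ψ) R (π / 2 - σ) / Real.sin σ
  rw [deriv_div_const, Function.iterate_succ_apply']
  show R * (deriv (fun R' => (Dz^[k] Ψ) R' (π / 2 - σ)) R / Real.sin σ) = R * deriv (fun R' => (Dz^[k] Ψ) R' (π / 2 - σ)) R / Real.sin σ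
  ring

/-- **The mixed partials `∂_σ^l z_k` form a `SlabFamily` on `[0,π/2)`.** [folklore] -/
theorem slabFamily_halfPi : SlabFamily (π / 2) (fun k l => dθ^[l] (zRefl Ψ k)) := by
  have hπ2 : (0:ℝ) < π / 2 := by positivity
  refine ⟨hπ2, fun k l => h.continuousOn_bext_zRefl k l, fun k l p hp => ?_, fun k l p hp => ?_⟩
  · have hs : ContDiffOn ℝ ∞ (uncurry (dθ^[l] (zRefl Ψ k))) strip := contDiffOn_iterate_dθ_strip (h.smooth_zRefl k) l
    have := h.hasDerivAt_sigma hs (p := p) hp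
    rwa [← Function.iterate_succ_apply' dθ l] at this
  · have hs : ContDiffOn ℝ ∞ (uncurry (dθ^[l] (zRefl Ψ k))) strip := contDiffOn_iterate_dθ_strip (h.smooth_zRefl k) l
    have hd := hasDerivAt_radial_Dz hs (p := p) hp
    rw [Dz_iterate_dθ_strip (h.smooth_zRefl k) l p hp, h.Dz_zRefl k] at hd
    exact hd

/-- **`(σ,s) ↦ z̃₀(eˢ,σ)` is `C^∞` on `[0,π/2) × ℝ` (within)**, `z₀ = Ψ(R,π/2−σ)/sin σ = χ(R, π/2 − σ)`.
[cite: Elgindi2021, §7.1 Proposition 7.1 (p. 19 of arXiv:1904.04795)] -/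
theorem contDiffOn_slab_halfPi : ContDiffOn ℝ ∞ (fun q : ℝ × ℝ => bext (zRefl Ψ 0) (Real.exp q.2, q.1)) (Ico 0 (π / 2) ×ˢ univ) :=
  h.slabFamily_halfPi.contDiffOn_slab 0

end TangentialFamily

end Elgindi

end Literature.Analysis.FluidPDE
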